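import Summits.BirchSwinnertonDyer.Rank1Residual.X2.NonsplitBDPExistsInt
import Summits.BirchSwinnertonDyer.Rank1Residual.X2.IntSeriesFirstUnitCoeff
import HarnessLib

/-!
# O9 (row B11): the Hida-limit road H and the two c3 halves over the WIDE receptacle `𝓞_{ℂ_p}⟦T⟧`
# (♭ twins of `X2/HidaLimitRoad.lean` p419866 and `X2/NonsplitIMCEqHalves.lean` p408417, glued to
# k5-c4's c3♭ `NonsplitIMCEqOnTreeInt`, p418462) — planner RULING L9-a rider (r2) (cell `bsd-eis`, seat
# `bsd-eis-cgshw` g7; route `EisensteinPrimes`, crux 4 `BSDpOnCellC`, line b1; memos cgshw MEMO-8 and MEMO-9)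

HONEST FRAMING (cell `bsd-eis`, run/shared/lean/pub/bsd-eis/): theorems + three hypothesis-shaped
`@[conjecture]` predicates; nothing booked; X2 stays CONSTRUCTION-SHAPED; no label or count moves.

## Why

k5-c4 re-based the non-split road of record on `𝓞_{ℂ_p}`-frames (`X11b.R1.IsBDPLFunctionInt`, Hsieh
2014 Thm. 1 alone supplies a frame — `exists_isBDPLFunctionInt_of_hsieh2014_of_classX2`, no
`R₀`-descent residual), with the IMC atom c3♭ = `NonsplitIMCEqOnTreeInt W p`
(`Ch_Λ(X_ac^∅)·𝓞_{ℂ_p}⟦T⟧ = (Q)` for every ♭-frame `Q`). The `R₀` files typed c3's two roads —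
Kolyvagin (c3-div ⊕ c3-μλ ⟹ c3, p408417) and Hida limit (`HidaLimitRevDivOnTree` ⊕ c3-μλ ⟹ c3,
p419866) — by the first-unit-coefficient algebra over `R₀`. This file is their ♭ transcription, the
algebra being the `𝓞_{ℂ_p}⟦T⟧` twin `X2.CpIntSeries.span_singleton_eq_of_C_pow_mul_mem` (p420633;
Gauss-norm step in place of DVR peeling):

* `NonsplitKolyvaginDivOnTreeInt W p` (c3♭-div) — for every ♭-frame `Q`: `∃ k, p^k·Q ∈
  Ch_Λ(X_ac^∅)·𝓞_{ℂ_p}⟦T⟧` (the KOLYVAGIN direction; provenance road R-β as in p408417's c3-div);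
* `NonsplitMuLambdaOnTreeInt W p` (c3♭-μλ) — Keller–Yin D′ read in `𝓞_{ℂ_p}`: the first unit
  coefficients of a generator `𝓕` of `Ch_Λ(X_ac^∅)` and of `Q` sit at the same index;
* `HidaLimitRevDivOnTreeInt W p` (road H ♭, SIGN-FREE as in p419866) — for every ♭-frame `Q` and
  generator `𝓕`: `∃ a, p^a·𝓕 ∈ (Q)` in `𝓞_{ℂ_p}⟦T⟧` (the REVERSE direction; provenance KY Thm. D″ =
  D′ + (α) [cgshw MEMO-9: from the étaleness of the ordinary family at `f_E`] + (b) [Cas20 §1.5] + (d)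
  [KY 3.0.8 for the members, weight-vs-`p` removed by cgshw MEMO-8]; its own frame is the weight-2
  specialisation of Castella's two-variable function in `Λ^nr = R₀⟦T⟧ ⊂ 𝓞_{ℂ_p}⟦T⟧`; by frame-ideal
  rigidity (k5-c4 `X2/NonsplitHalvesIntRigidity`, `X11b.R1.imcEqIntAt_iff_of_isBDPLFunctionInt`) the
  ∀-frame and one-frame forms agree);
* glue: `nonsplitIMCEqOnTreeInt_of_divInt_of_muLambdaInt` (c3♭-div ⊕ c3♭-μλ ⟹ c3♭) and
  `nonsplitIMCEqOnTreeInt_of_hidaLimitRevDivInt_of_muLambdaInt` (road H ♭ ⊕ c3♭-μλ ⟹ c3♭), and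
  `imcEqInt_of_divInt_or_hidaLimitRevDivInt_of_muLambdaInt` (either divisibility half suffices).

Attach point (planner 03:45:50Z (2)): the ∀-frame c3♭ (`NonsplitIMCEqOnTreeInt`) — the glue is a
verbatim copy of the `R₀` glue; the one-frame form `NonsplitIMCEqSomeFrameOnTreeInt` then follows from
k5-c4's `nonsplitIMCEqSomeFrameOnTreeInt_of_onTreeInt` once a frame exists (Hsieh). Split sign: the
`R₀` form stays (g6's `SplitIMCEqOnTree`, p416318) until g6 re-bases the split road; the sign-free
road-H predicate here already covers split data.

What this is NOT: not a proof of either divisibility or of D′; the registered stubs of line b1 are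
untouched; this file adds ♭ receptacles and glue, it replaces nothing (RULING L7/L9-a).

References: [KellerYin2024] §5, Thm. 5.1.3 = Thm. D (arXiv:2402.12781v2; PRE); [Hsieh2014] Thm. 1,
p. 7 (the receptacle); [Washington1997] §7.1; cell memos bsd-eis-ky MEMO-2, cgshw MEMO-8, MEMO-9,
k5-c4 MEMO-1.
-/

set_option autoImplicit false

noncomputable section

open scoped Classical MatrixGroups ModularForm

open CongruenceSubgroup WeierstrassCurve NumberField IsDedekindDomain Field PowerSeries
  Literature.NumberTheory.EllipticCurves Literature.NumberTheory.EllipticCurves.GreenbergSelmer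
  Literature.NumberTheory.EllipticCurves.ModularForms
  Literature.NumberTheory.EllipticCurves.Rank1Residual
  Literature.NumberTheory.EllipticCurves.Rank1Residual.Typed
  Literature.NumberTheory.GaloisRepresentations Literature.NumberTheory.GaloisCohomology
  Literature.NumberTheory.Automorphic
  Summit.BirchSwinnertonDyer.Rank1Residual.X11b.AcSelmer
  Summit.BirchSwinnertonDyer.Rank1Residual.X11b.Halves
  Summit.BirchSwinnertonDyer.Rank1Residual.X11b

namespace Summit.BirchSwinnertonDyer.Rank1Residual.X2

section ResidualsInt

variable (W : WeierstrassCurve ℚ) [W.IsElliptic] [W.IsGloballyMinimal] (p : ℕ) [Fact p.Prime]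

/-- **c3♭-div — `NonsplitKolyvaginDivOnTreeInt W p`: ONE DIVISIBILITY in the anticyclotomic IMC at a
NON-split Eisenstein `p ‖ N`, after inverting `p`, over `𝓞_{ℂ_p}`-frames** (the ♭ twin of
`NonsplitKolyvaginDivOnTree W p`, p408417: same binders as k5-c4's c3♭, conclusion `∃ k, p^k · Q ∈
Ch_Λ(X_ac^∅(E[p^∞]))·𝓞_{ℂ_p}⟦T⟧`). PROVENANCE = road R-β exactly as in p408417's docstring (the reducible
weight-2 Heegner-point Kolyvagin system at `p ‖ N` + CGS 2025 Thm. 5.5.1 + Castella arXiv:2409.01360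
Cor. 2.3 / Prop. 3.2; NOT assembled in print at a reducible `p ‖ N`), read in the wide receptacle.
TYPED, not attempted; nothing asserted; consumed as a hypothesis. [claim: Castella2024, status: under-review]
[cite: CastellaGrossiSkinner2025, Thm. 5.5.1 (shape only; nothing asserted)]
[cite: Hsieh2014, Thm. 1 and p. 7 (arXiv:1112.1580) (the receptacle `Z̄_p⟦Γ⁻⟧ ⊆ 𝓞_{ℂ_p}⟦T⟧`)] -/
@[conjecture]
def NonsplitKolyvaginDivOnTreeInt : Prop :=
  ∀ (N : ℕ) [NeZero N] (K : Type) [Field K] [NumberField K] (Dt : ModularParametrizationData W N)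
    (H : HeegnerDatum N (NumberField.discr K)) (ιK : K →+* ℂ) (P : (W.baseChange K).toAffine.Point),
    CellC W p → ¬ W.HasSplitMultiplicativeReductionAtPrime p → W.conductorNorm ℤ = N →
    IsImaginaryQuadratic K → NumberField.discr K < -4 → SatisfiesHeegnerHypothesis N K →
    (W.quadraticTwist (NumberField.discr K : ℚ)).entireLFunction 1 ≠ 0 →
    WeierstrassCurve.Affine.Point.map ιK.toRatAlgHom P = heegnerPointComplex Dt H →
    ¬ (p : ℤ) ∣ Dt.c → ¬ IsOfFinAddOrder P →
    ∀ (κ : ZpExtension K p), κ.IsAnticyclotomic →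
      ∀ (γ : Field.absoluteGaloisGroup K) [Fact (κ.IsTopGenerator γ)]
        (𝔭 : HeightOneSpectrum (𝓞 K)), ((p : ℕ) : 𝓞 K) ∈ 𝔭.asIdeal →
        𝔭.asIdeal.ramificationIdx (𝓞 ℚ) = 1 → 𝔭.asIdeal.inertiaDeg (𝓞 ℚ) = 1 →
        ∀ (f : CuspForm (CongruenceSubgroup.Gamma0 N) 2), IsNewformOf W f →
          ∀ (ι' : PadicAlgCl p ≃+* ℂ),
            (∀ (w : InfinitePlace K) (k : 𝓞 K),
              k ∈ 𝔭.asIdeal ↔ ‖ι'.symm (w.embedding (k : K))‖ < 1) →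
            ∀ (ΩK : ℂ) (Ωp : ℂ_[p]) (Q : PowerSeries 𝓞_ℂ_[p]), ΩK ≠ 0 → ‖Ωp‖ = 1 →
              R1.IsBDPLFunctionInt p ι' 𝔭 κ γ f ΩK Ωp Q →
                ∃ k : ℕ, PowerSeries.C ((p : 𝓞_ℂ_[p]) ^ k) * Q ∈
                  (XAc.charIdeal (W.baseChange K) p κ 𝔭 ∅ γ).map (PowerSeries.map (R1.toCpInt p))

/-- **c3♭-μλ — `NonsplitMuLambdaOnTreeInt W p`: KELLER–YIN D′ (`μ = 0` AND `λ`-EQUALITY) at a NON-split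
Eisenstein `p ‖ N`, read in `𝓞_{ℂ_p}`** (the ♭ twin of `NonsplitMuLambdaOnTree W p`, p408417): for every
♭-frame `Q` and every generator `𝓕` of `Ch_Λ(X_ac^∅(E[p^∞]))`, the first coefficient of norm `1` of `𝓕`
(read in `ℂ_p` through `ℤ_p → 𝓞_{ℂ_p}`) and that of `Q` sit at the SAME index `n`. PRINT: Keller–Yin
arXiv:2402.12781v2 Thm. 5.1.3 (= Thm. D), the part D′ of its proof (bsd-eis-ky MEMO-2 §3, referee PASS) —
UNREFEREED PREPRINT; NEVER cite this `Prop` as a theorem; consumed as a hypothesis.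
[claim: KellerYin2024, status: under-review]
[cite: KellerYin2024, Thm. 5.1.3 = Thm. D (arXiv:2402.12781v2 §5.1), the part D′ of its proof]
[cite: Washington1997, §7.1 Prop. 7.2 and §13.2 (μ, λ as first unit coefficient)] -/
@[conjecture]
def NonsplitMuLambdaOnTreeInt : Prop :=
  ∀ (N : ℕ) [NeZero N] (K : Type) [Field K] [NumberField K] (Dt : ModularParametrizationData W N)
    (H : HeegnerDatum N (NumberField.discr K)) (ιK : K →+* ℂ) (P : (W.baseChange K).toAffine.Point),
    CellC W p → ¬ W.HasSplitMultiplicativeReductionAtPrime p → W.conductorNorm ℤ = N →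
    IsImaginaryQuadratic K → NumberField.discr K < -4 → SatisfiesHeegnerHypothesis N K →
    (W.quadraticTwist (NumberField.discr K : ℚ)).entireLFunction 1 ≠ 0 →
    WeierstrassCurve.Affine.Point.map ιK.toRatAlgHom P = heegnerPointComplex Dt H →
    ¬ (p : ℤ) ∣ Dt.c → ¬ IsOfFinAddOrder P →
    ∀ (κ : ZpExtension K p), κ.IsAnticyclotomic →
      ∀ (γ : Field.absoluteGaloisGroup K) [Fact (κ.IsTopGenerator γ)]
        (𝔭 : HeightOneSpectrum (𝓞 K)), ((p : ℕ) : 𝓞 K) ∈ 𝔭.asIdeal →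
        𝔭.asIdeal.ramificationIdx (𝓞 ℚ) = 1 → 𝔭.asIdeal.inertiaDeg (𝓞 ℚ) = 1 →
        ∀ (f : CuspForm (CongruenceSubgroup.Gamma0 N) 2), IsNewformOf W f →
          ∀ (ι' : PadicAlgCl p ≃+* ℂ),
            (∀ (w : InfinitePlace K) (k : 𝓞 K),
              k ∈ 𝔭.asIdeal ↔ ‖ι'.symm (w.embedding (k : K))‖ < 1) →
            ∀ (ΩK : ℂ) (Ωp : ℂ_[p]) (Q : PowerSeries 𝓞_ℂ_[p]), ΩK ≠ 0 → ‖Ωp‖ = 1 →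
              R1.IsBDPLFunctionInt p ι' 𝔭 κ γ f ΩK Ωp Q →
                ∀ F : IwasawaAlgebra p,
                  XAc.charIdeal (W.baseChange K) p κ 𝔭 ∅ γ = Ideal.span {F} →
                  ∃ n : ℕ,
                    (‖((PowerSeries.coeff n (PowerSeries.map (R1.toCpInt p) F) : 𝓞_ℂ_[p]) : ℂ_[p])‖ = 1 ∧
                      ∀ i < n, ‖((PowerSeries.coeff i (PowerSeries.map (R1.toCpInt p) F) :
                        𝓞_ℂ_[p]) : ℂ_[p])‖ < 1) ∧
                    (‖((PowerSeries.coeff n Q : 𝓞_ℂ_[p]) : ℂ_[p])‖ = 1 ∧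
                      ∀ i < n, ‖((PowerSeries.coeff i Q : 𝓞_ℂ_[p]) : ℂ_[p])‖ < 1)

/-- **Road H ♭ — `HidaLimitRevDivOnTreeInt W p`: the REVERSE one-sided divisibility
"`p^a · Ch_Λ(X_ac^∅(E[p^∞]))·𝓞_{ℂ_p}⟦T⟧ ⊆ (Q)`" over `𝓞_{ℂ_p}`-frames, BOTH signs** (the ♭ twin of
`HidaLimitRevDivOnTree W p`, p419866; NO sign binder): for every X2c Heegner datum, every ♭-frame `Q`
and every generator `𝓕` of `Ch_Λ(X_ac^∅)`: `∃ a, p^a · 𝓕 ∈ (Q)` in `𝓞_{ℂ_p}⟦T⟧`. PROVENANCE (road H;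
NOT in print as one statement): Keller–Yin v2 §5 Thm. D″ — the one-sided congruence limit (kernel over
`ℤ_p⟦T⟧`: `X2.KellerYinFreePartGap.charIdeal_eq_span_of_oneSided_congruences`) fed by (α) [lattice
congruences; cgshw MEMO-9: from the étaleness of the ordinary Hida family at the p-new weight-2 point
`f_E` (Hida, Invent. 85 (1986) Cor. 1.4; regular local analytic branch `𝒪⟦S′⟧`; Bellaïche–Chenevier
Prop. 1.6.1; Skinner's specialisation verbatim)], (b) [Castella JIMJ 2020 §1.5 two-variable BDP
function; rider `p ∤ h_K`] and (d) [KY Thm. 3.0.8 for the good members, weight-vs-`p` removed by cgshw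
MEMO-8]. FRAMES: hypothesis-shaped over ALL ♭-frames; road H's own frame (the weight-2 specialisation of
[Cas20 §1.5], in `Λ^nr = R₀⟦T⟧ ⊂ 𝓞_{ℂ_p}⟦T⟧`) is one of them, and frame-ideal rigidity (k5-c4) makes the
one-frame and ∀-frame forms equivalent. A predicate on `(W, p)`; TYPED, not attempted; nothing
asserted; every result using it is CONDITIONAL. [claim: KellerYin2024, status: under-review]
[cite: KellerYin2024, §5.1 (a)–(e), Lemma 5.1.2, Thm. 5.1.3 = Thm. D and Thm. 3.0.8 (arXiv:2402.12781v2)]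
[cite: Hida1986, Cor. 1.4 (Invent. Math. 85) (étaleness of the ordinary family at arithmetic points of weight ≥ 2)]
[cite: Skinner2016PacificMC, §3.1 (p. 192) (shape of the congruence limit)] -/
@[conjecture]
def HidaLimitRevDivOnTreeInt : Prop :=
  ∀ (N : ℕ) [NeZero N] (K : Type) [Field K] [NumberField K] (Dt : ModularParametrizationData W N)
    (H : HeegnerDatum N (NumberField.discr K)) (ιK : K →+* ℂ) (P : (W.baseChange K).toAffine.Point),
    CellC W p → W.conductorNorm ℤ = N →
    IsImaginaryQuadratic K → NumberField.discr K < -4 → SatisfiesHeegnerHypothesis N K →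
    (W.quadraticTwist (NumberField.discr K : ℚ)).entireLFunction 1 ≠ 0 →
    WeierstrassCurve.Affine.Point.map ιK.toRatAlgHom P = heegnerPointComplex Dt H →
    ¬ (p : ℤ) ∣ Dt.c → ¬ IsOfFinAddOrder P →
    ∀ (κ : ZpExtension K p), κ.IsAnticyclotomic →
      ∀ (γ : Field.absoluteGaloisGroup K) [Fact (κ.IsTopGenerator γ)]
        (𝔭 : HeightOneSpectrum (𝓞 K)), ((p : ℕ) : 𝓞 K) ∈ 𝔭.asIdeal →
        𝔭.asIdeal.ramificationIdx (𝓞 ℚ) = 1 → 𝔭.asIdeal.inertiaDeg (𝓞 ℚ) = 1 →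
        ∀ (f : CuspForm (CongruenceSubgroup.Gamma0 N) 2), IsNewformOf W f →
          ∀ (ι' : PadicAlgCl p ≃+* ℂ),
            (∀ (w : InfinitePlace K) (k : 𝓞 K),
              k ∈ 𝔭.asIdeal ↔ ‖ι'.symm (w.embedding (k : K))‖ < 1) →
            ∀ (ΩK : ℂ) (Ωp : ℂ_[p]) (Q : PowerSeries 𝓞_ℂ_[p]), ΩK ≠ 0 → ‖Ωp‖ = 1 →
              R1.IsBDPLFunctionInt p ι' 𝔭 κ γ f ΩK Ωp Q →
                ∀ F : IwasawaAlgebra p,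
                  XAc.charIdeal (W.baseChange K) p κ 𝔭 ∅ γ = Ideal.span {F} →
                  ∃ a : ℕ, PowerSeries.C ((p : 𝓞_ℂ_[p]) ^ a) * PowerSeries.map (R1.toCpInt p) F ∈
                    Ideal.span ({Q} : Set (PowerSeries 𝓞_ℂ_[p]))

end ResidualsInt

/-! ### Glue over `𝓞_{ℂ_p}⟦T⟧`: either divisibility half + D′ ⟹ c3♭ -/

section GlueInt

variable {W : WeierstrassCurve ℚ} [W.IsElliptic] [W.IsGloballyMinimal] {p : ℕ} [Fact p.Prime]

omit [W.IsElliptic] [W.IsGloballyMinimal] in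
/-- **c3♭ from its Kolyvagin halves, in the kernel: c3♭-div + c3♭-μλ ⟹ `NonsplitIMCEqOnTreeInt W p`**
(the ♭ transcription of `nonsplitIMCEqOnTree_of_div_of_muLambda`, p408417, through
`X2.CpIntSeries.span_singleton_eq_of_C_pow_mul_mem`, p420633, and the principality of characteristic
ideals). CONDITIONAL on the two typed halves; nothing booked.
[cite: KellerYin2024, proof of Thm. 3.0.8 (the closing by μ = 0 and λ)] [cite: Washington1997, §7.1 Prop. 7.2] -/
theorem nonsplitIMCEqOnTreeInt_of_divInt_of_muLambdaInt (hdiv : NonsplitKolyvaginDivOnTreeInt W p)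
    (hml : NonsplitMuLambdaOnTreeInt W p) : NonsplitIMCEqOnTreeInt W p := by
  intro N _ K _ _ Dt H ιK P hc hns hN hK hd4 hHN hLt hP hcM hPinf κ hκ γ _ 𝔭 h𝔭 he hf f hfW ι' hι'
    ΩK Ωp Q hΩK hΩp hQ
  obtain ⟨k, hk⟩ := hdiv N K Dt H ιK P hc hns hN hK hd4 hHN hLt hP hcM hPinf κ hκ γ 𝔭 h𝔭 he hf f
    hfW ι' hι' ΩK Ωp Q hΩK hΩp hQ
  obtain ⟨F, hF⟩ :=
    (charIdeal_isPrincipal_holds p (XAc (W.baseChange K) p κ 𝔭 ∅ γ)).principal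
  have hchar : XAc.charIdeal (W.baseChange K) p κ 𝔭 ∅ γ = Ideal.span {F} := hF
  obtain ⟨n, hFn, hQn⟩ := hml N K Dt H ιK P hc hns hN hK hd4 hHN hLt hP hcM hPinf κ hκ γ 𝔭 h𝔭 he
    hf f hfW ι' hι' ΩK Ωp Q hΩK hΩp hQ F hchar
  unfold R1.IMCEqIntAt
  rw [hchar, Ideal.map_span, Set.image_singleton] at hk ⊢
  exact CpIntSeries.span_singleton_eq_of_C_pow_mul_mem hk hFn hQn

omit [W.IsElliptic] [W.IsGloballyMinimal] in
/-- **c3♭ from the Hida-limit road, in the kernel: `HidaLimitRevDivOnTreeInt` + c3♭-μλ ⟹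
`NonsplitIMCEqOnTreeInt W p`** (the ♭ transcription of `nonsplitIMCEqOnTree_of_hidaLimitRevDiv_of_muLambda`,
p419866: the same algebra with the roles of `𝓕` and `Q` EXCHANGED). CONDITIONAL on the two typed
hypotheses; nothing booked.
[cite: KellerYin2024, Lemma 5.1.2 and proof of Thm. 3.0.8 (arXiv:2402.12781v2)] [cite: Washington1997, §7.1 Prop. 7.2] -/
theorem nonsplitIMCEqOnTreeInt_of_hidaLimitRevDivInt_of_muLambdaInt (hrev : HidaLimitRevDivOnTreeInt W p)
    (hml : NonsplitMuLambdaOnTreeInt W p) : NonsplitIMCEqOnTreeInt W p := by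
  intro N _ K _ _ Dt H ιK P hc hns hN hK hd4 hHN hLt hP hcM hPinf κ hκ γ _ 𝔭 h𝔭 he hf f hfW ι' hι'
    ΩK Ωp Q hΩK hΩp hQ
  obtain ⟨F, hF⟩ :=
    (charIdeal_isPrincipal_holds p (XAc (W.baseChange K) p κ 𝔭 ∅ γ)).principal
  have hchar : XAc.charIdeal (W.baseChange K) p κ 𝔭 ∅ γ = Ideal.span {F} := hF
  obtain ⟨a, ha⟩ := hrev N K Dt H ιK P hc hN hK hd4 hHN hLt hP hcM hPinf κ hκ γ 𝔭 h𝔭 he hf f hfW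
    ι' hι' ΩK Ωp Q hΩK hΩp hQ F hchar
  obtain ⟨n, hFn, hQn⟩ := hml N K Dt H ιK P hc hns hN hK hd4 hHN hLt hP hcM hPinf κ hκ γ 𝔭 h𝔭 he
    hf f hfW ι' hι' ΩK Ωp Q hΩK hΩp hQ F hchar
  unfold R1.IMCEqIntAt
  rw [hchar, Ideal.map_span, Set.image_singleton]
  exact (CpIntSeries.span_singleton_eq_of_C_pow_mul_mem ha hQn hFn).symm

omit [W.IsElliptic] [W.IsGloballyMinimal] in
/-- **Either divisibility half suffices** (with D′): `(c3♭-div ∨ HidaLimitRevDivInt) ∧ c3♭-μλ ⟹ c3♭`.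
CONDITIONAL; nothing booked. [folklore] -/
theorem imcEqInt_of_divInt_or_hidaLimitRevDivInt_of_muLambdaInt
    (hdiv : NonsplitKolyvaginDivOnTreeInt W p ∨ HidaLimitRevDivOnTreeInt W p)
    (hml : NonsplitMuLambdaOnTreeInt W p) : NonsplitIMCEqOnTreeInt W p := by
  rcases hdiv with hd | hrev
  · exact nonsplitIMCEqOnTreeInt_of_divInt_of_muLambdaInt hd hml
  · exact nonsplitIMCEqOnTreeInt_of_hidaLimitRevDivInt_of_muLambdaInt hrev hml

omit [W.IsElliptic] [W.IsGloballyMinimal] in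
/-- **Consistency on the non-split side**: c3♭ ⟹ c3♭-div (with `k = 0`) — the Kolyvagin half is
never stronger than the target. [folklore] -/
theorem nonsplitKolyvaginDivOnTreeInt_of_imcEqInt (h : NonsplitIMCEqOnTreeInt W p) :
    NonsplitKolyvaginDivOnTreeInt W p := by
  intro N _ K _ _ Dt H ιK P hc hns hN hK hd4 hHN hLt hP hcM hPinf κ hκ γ _ 𝔭 h𝔭 he hf f hfW ι' hι'
    ΩK Ωp Q hΩK hΩp hQ
  have himc : R1.IMCEqIntAt W p κ 𝔭 γ Q := h N K Dt H ιK P hc hns hN hK hd4 hHN hLt hP hcM hPinf κ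
    hκ γ 𝔭 h𝔭 he hf f hfW ι' hι' ΩK Ωp Q hΩK hΩp hQ
  refine ⟨0, ?_⟩
  unfold R1.IMCEqIntAt at himc
  rw [himc, pow_zero, map_one, one_mul]
  exact Ideal.subset_span rfl

end GlueInt

end Summit.BirchSwinnertonDyer.Rank1Residual.X2

end
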